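import Summits.AtomisticToContinuum.BoseEinsteinCondensation.Theses.BECStronglyRayleigh
import Summits.AtomisticToContinuum.BoseEinsteinCondensation.Theorems.BECStronglyRayleighInsertionFieldDelocalisationTwoBodyBase
import Summits.AtomisticToContinuum.BoseEinsteinCondensation.Theorems.BECStronglyRayleighInsertionFieldDelocalisationTwoBodyBaseEnergy
import Summits.AtomisticToContinuum.BoseEinsteinCondensation.Theorems.BECStronglyRayleighInsertionFieldDelocalisationTranslationInvariance
import Summits.AtomisticToContinuum.BoseEinsteinCondensation.Theorems.BECStronglyRayleighInsertionFieldDelocalisationEmbedding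
import Summits.AtomisticToContinuum.BoseEinsteinCondensation.Theorems.BECStronglyRayleighKineticLatticeBECInsertionInfidelityLowPrelim
import HarnessLib

/-!
# Stub `stub_insertionInfidelityLow` (Stub A-low of line `Sketch`, crux `KineticLatticeBEC`, stmt-AtomisticToContinuum-9671)

**The dilute rungs `N = 0, 1` of the insertion-fidelity bound, from two-body `ℓ²`-flatness.** Hard-core
bosons on `(ℤ/Lℤ)³` = the ferro spin-½ XY model `xyTorus 3 L 1` (occupied = up = index `0`,
`1_S = fun z => if z ∈ S then 0 else 1`), `Ŝ⁺_tot = totalSpin 1 0 + I • totalSpin 1 1 = Σ_x onSite x (spinRaise 1)`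
(`LiebMattis.totalSpin_raise_eq_sum_onSite`; `(Ŝ⁺ψ)(σ) = Σ_{x : σ x = 0} ψ(σ[x ↦ 1])`, `LiebMattis.raise_mulVec_apply`
+ `LiebMattis.sum_spinRaise_apply_mul`). Admissible data of the sector `N − L³/2` are supported on the
indicators of `N`-sets (`LiebMattis.mem_spinZSector_weight_iff`) and are translation invariant (Perron
uniqueness, as in the landed `stub_translationInvariance`, whose proof never uses its hypothesis `2 ≤ N`).
The occupation-basis bookkeeping (`iil_*`: `Ŝ⁺` adds a boson, sums over configurations = sums over
occupied sets, double counting of pairs, sector support, flat one-particle data) is in the landed helper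
file `Theorems/BECStronglyRayleighKineticLatticeBECInsertionInfidelityLowPrelim.lean`.

* Rung `N = 0`: `ψ₀ = a·δ_{⇓}` (`a > 0`), `Ŝ⁺ψ₀ = a·1_{singletons}`, `ψ₁ = b·1_{singletons}` (`b > 0`): the three
  quantities are `⟨ψ₁,Ŝ⁺ψ₀⟩ = abL³`, `‖Ŝ⁺ψ₀‖² = a²L³`, `‖ψ₁‖² = b²L³` — fidelity exactly `1`, any `K ≥ 0` works.
* Rung `N = 1`: `ψ₀ = a·1_{singletons}`, `Ŝ⁺ψ₀ = 2a·1_{pairs}`; for `ψ₁` (two particles) the landed two-body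
  machinery (`cb1tb_main`'s first half: `stub_translationInvariance`, pair profile `g(v) = Re ψ₁(1_{{v,0}})`,
  `g(0) = 0`, `g ≥ 0`, punctured resolvent equation from `stub_embedding`, `cb1tb_energy_bound`) gives
  `⟨ψ₁,Ŝ⁺ψ₀⟩ = a L³ Σg`, `‖ψ₁‖² = (L³/2) Σg²`, `‖Ŝ⁺ψ₀‖² = 2a² L³(L³−1)`, so the rung inequality reads
  `(1 − K/√(2L³)) (L³ − 1) Σg² ≤ (Σg)²`, which the hypothesis (two-body `ℓ²`-flatness,
  `L³Σg² ≤ (1 + 400/L²)(Σg)²`) gives for `K = 600` (`400/L² ≤ 600/√(2L³)` for all `L ≥ 1`; if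
  `600/√(2L³) ≥ 1` the left side is `≤ 0`).
-/

noncomputable section

namespace Summit.AtomisticToContinuum.BoseEinsteinCondensation.Cruxes.KineticLatticeBEC.SectorLadder

open scoped BigOperators Matrix ComplexOrder
open Literature.MathematicalPhysics.QuantumLattice Literature.Probability.LatticeModels Matrix Complex Finset
open Summit.AtomisticToContinuum.BoseEinsteinCondensation.Theses.BECStronglyRayleigh
open Summit.AtomisticToContinuum.BoseEinsteinCondensation.Theorems.InsertionFieldDelocalisation.Negative
open Summit.AtomisticToContinuum.BoseEinsteinCondensation.Cruxes.InsertionFieldDelocalisation.CoshBudgetPenroseOnsager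
  (cb1tb_energy_bound cb1tb_pair_translate cb1tb_adj_iff_sub)
open Summit.AtomisticToContinuum.BoseEinsteinCondensation.Cruxes.InsertionFieldDelocalisation.LogInsertionInfraredBound
  (stub_translationInvariance)
open Summit.AtomisticToContinuum.BoseEinsteinCondensation.Cruxes.InsertionFieldDelocalisation.MobileTrapDirichletEigenfunction
  (stub_embedding)

/-! ### The two rungs -/

/-- **Rung `N = 0`** (vacuum → one particle): `ψ₀ = α·δ_⇓`, `Ŝ⁺ψ₀ = α·1_{singletons}`,
`ψ₁ = β·1_{singletons}`, so `⟨ψ₁, Ŝ⁺ψ₀⟩ = L³βα`, `‖Ŝ⁺ψ₀‖² = L³α²`, `‖ψ₁‖² = L³β²`: Cauchy–Schwarz is an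
equality and any nonnegative defect `600/√t` is allowed. [folklore] -/
theorem iil_rung_zero (L : ℕ) [NeZero L] (hL : 2 ≤ L) (t M₀ M₁ : ℝ)
    (hM₀ : M₀ = ((0 : ℕ) : ℝ) - (L : ℝ) ^ 3 / 2) (hM₁ : M₁ = ((1 : ℕ) : ℝ) - (L : ℝ) ^ 3 / 2)
    (ψ₀ ψ₁ : TensorIndex (TorusSite 3 L) 2 → ℂ)
    (h₀nn : ∀ σ, 0 ≤ (ψ₀ σ).re ∧ (ψ₀ σ).im = 0) (h₀sec : ψ₀ ∈ spinZSector 1 M₀)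
    (h₁ne : ψ₁ ≠ 0) (h₁nn : ∀ σ, 0 ≤ (ψ₁ σ).re ∧ (ψ₁ σ).im = 0) (h₁sec : ψ₁ ∈ spinZSector 1 M₁)
    (h₁eig : (xyTorus 3 L 1) *ᵥ ψ₁ = ((lowestEnergyInSector 1 (xyTorus 3 L 1) M₁ : ℝ) : ℂ) • ψ₁) :
    (1 - 600 / Real.sqrt t) *
        (star ((totalSpin 1 0 + I • totalSpin 1 1 : Op (TorusSite 3 L) 2) *ᵥ ψ₀) ⬝ᵥ
          ((totalSpin 1 0 + I • totalSpin 1 1 : Op (TorusSite 3 L) 2) *ᵥ ψ₀)).re *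
        (star ψ₁ ⬝ᵥ ψ₁).re ≤
      ‖star ψ₁ ⬝ᵥ ((totalSpin 1 0 + I • totalSpin 1 1 : Op (TorusSite 3 L) 2) *ᵥ ψ₀)‖ ^ 2 := by
  subst hM₀ hM₁
  have hcard := iil_card_real L
  set w := (totalSpin 1 0 + I • totalSpin 1 1 : Op (TorusSite 3 L) 2) *ᵥ ψ₀ with hw
  set α : ℂ := ψ₀ (fun z => if z ∈ (∅ : Finset (TorusSite 3 L)) then 0 else 1) with hα
  set β : ℂ := ψ₁ (fun z => if z ∈ ({0} : Finset (TorusSite 3 L)) then 0 else 1) with hβ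
  have hflat0 : ∀ S : Finset (TorusSite 3 L), ψ₀ (fun z => if z ∈ S then 0 else 1) =
      if S.card = 0 then α else 0 := by
    intro S
    by_cases hS : S.card = 0
    · rw [if_pos hS, Finset.card_eq_zero.1 hS]
    · rw [if_neg hS]
      exact iil_apply_ind_eq_zero ψ₀ 0 _ (by rw [hcard]) h₀sec S hS
  have hflat1 : ∀ S : Finset (TorusSite 3 L), ψ₁ (fun z => if z ∈ S then 0 else 1) =
      if S.card = 1 then β else 0 := iil_one_flat L hL ψ₁ h₁sec h₁ne h₁eig h₁nn
  have hwS : ∀ S : Finset (TorusSite 3 L), w (fun z => if z ∈ S then 0 else 1) =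
      if S.card = 1 then α else 0 := fun S => by
    rw [hw, iil_raise_flat ψ₀ 0 α hflat0 S]
    norm_num
  have hwim : ∀ σ, (w σ).im = 0 := iil_raise_im ψ₀ (fun σ => (h₀nn σ).2)
  have h1im : ∀ σ, (ψ₁ σ).im = 0 := fun σ => (h₁nn σ).2
  have hL1 : ((Fintype.card (TorusSite 3 L)).choose 1 : ℝ) = (L : ℝ) ^ 3 := by
    rw [Nat.choose_one_right, hcard]
  have hX : star ψ₁ ⬝ᵥ w = (((L : ℝ) ^ 3 * (β.re * α.re) : ℝ) : ℂ) := by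
    rw [iil_star_dotProduct_real ψ₁ w h1im hwim, iil_sum_config (fun σ => (ψ₁ σ).re * (w σ).re)]
    congr 1
    rw [← hL1, ← iil_sum_card_ite 1 (β.re * α.re)]
    refine Finset.sum_congr rfl fun S _ => ?_
    rw [hflat1 S, hwS S]
    split_ifs <;> simp
  have hY : (star w ⬝ᵥ w).re = (L : ℝ) ^ 3 * (α.re * α.re) := by
    rw [iil_star_dotProduct_real w w hwim hwim, Complex.ofReal_re,
      iil_sum_config (fun σ => (w σ).re * (w σ).re), ← hL1, ← iil_sum_card_ite 1 (α.re * α.re)]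
    refine Finset.sum_congr rfl fun S _ => ?_
    rw [hwS S]
    split_ifs <;> simp
  have hZ : (star ψ₁ ⬝ᵥ ψ₁).re = (L : ℝ) ^ 3 * (β.re * β.re) := by
    rw [iil_star_dotProduct_real ψ₁ ψ₁ h1im h1im, Complex.ofReal_re,
      iil_sum_config (fun σ => (ψ₁ σ).re * (ψ₁ σ).re), ← hL1, ← iil_sum_card_ite 1 (β.re * β.re)]
    refine Finset.sum_congr rfl fun S _ => ?_
    rw [hflat1 S]
    split_ifs <;> simp
  rw [hX, hY, hZ, Complex.norm_real, Real.norm_eq_abs, sq_abs]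
  have hκ0 : 0 ≤ 600 / Real.sqrt t := div_nonneg (by norm_num) (Real.sqrt_nonneg t)
  have hP : 0 ≤ 600 / Real.sqrt t * ((L : ℝ) ^ 3 * (β.re * α.re)) ^ 2 := mul_nonneg hκ0 (sq_nonneg _)
  calc (1 - 600 / Real.sqrt t) * ((L : ℝ) ^ 3 * (α.re * α.re)) * ((L : ℝ) ^ 3 * (β.re * β.re))
      = ((L : ℝ) ^ 3 * (β.re * α.re)) ^ 2 - 600 / Real.sqrt t * ((L : ℝ) ^ 3 * (β.re * α.re)) ^ 2 := by
        ring
    _ ≤ ((L : ℝ) ^ 3 * (β.re * α.re)) ^ 2 := by linarith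

/-- **Rung `N = 1`** (one → two particles), from two-body `ℓ²`-flatness `hF`: `ψ₀ = α·1_{singletons}`,
`Ŝ⁺ψ₀ = 2α·1_{pairs}`, `Re ψ₁(1_{{x,y}}) = g(x - y)` for the pair profile `g` of the landed two-body
embedding, so `⟨ψ₁, Ŝ⁺ψ₀⟩ = L³ a Σg`, `‖Ŝ⁺ψ₀‖² = 2a²L³(L³ - 1)`, `‖ψ₁‖² = (L³/2) Σg²`, and the rung
inequality `(1 - 600/√(2L³))(L³ - 1)Σg² ≤ (Σg)²` follows from `L³Σg² ≤ (1 + 400/L²)(Σg)²` and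
`400/L² ≤ 600/√(2L³)`. [folklore] -/
theorem iil_rung_one (L : ℕ) [NeZero L] (hL : 2 ≤ L)
    (hF : ∀ (g : TorusSite 3 L → ℝ) (E s : ℝ), (∀ v, 0 ≤ g v) → g 0 = 0 →
      ((∑ b : TorusSite 3 L, (if (torusGraph 3 L).Adj 0 b then (1 : ℝ) else 0)) + E) *
          ((L : ℝ) ^ 3 - 1) ≤ 6 →
      (∀ v, (∑ y, if (torusGraph 3 L).Adj v y then g y else 0) + E * g v =
        if v = 0 then s else 0) →
      (L : ℝ) ^ 3 * ∑ v, g v ^ 2 ≤ (1 + 400 / (L : ℝ) ^ 2) * (∑ v, g v) ^ 2)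
    (t M₀ M₁ : ℝ) (ht : t = (L : ℝ) ^ 3 * 2)
    (hM₀ : M₀ = ((1 : ℕ) : ℝ) - (L : ℝ) ^ 3 / 2) (hM₁ : M₁ = ((2 : ℕ) : ℝ) - (L : ℝ) ^ 3 / 2)
    (ψ₀ ψ₁ : TensorIndex (TorusSite 3 L) 2 → ℂ)
    (h₀ne : ψ₀ ≠ 0) (h₀nn : ∀ σ, 0 ≤ (ψ₀ σ).re ∧ (ψ₀ σ).im = 0) (h₀sec : ψ₀ ∈ spinZSector 1 M₀)
    (h₀eig : (xyTorus 3 L 1) *ᵥ ψ₀ = ((lowestEnergyInSector 1 (xyTorus 3 L 1) M₀ : ℝ) : ℂ) • ψ₀)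
    (h₁ne : ψ₁ ≠ 0) (h₁nn : ∀ σ, 0 ≤ (ψ₁ σ).re ∧ (ψ₁ σ).im = 0) (h₁sec : ψ₁ ∈ spinZSector 1 M₁)
    (h₁eig : (xyTorus 3 L 1) *ᵥ ψ₁ = ((lowestEnergyInSector 1 (xyTorus 3 L 1) M₁ : ℝ) : ℂ) • ψ₁) :
    (1 - 600 / Real.sqrt t) *
        (star ((totalSpin 1 0 + I • totalSpin 1 1 : Op (TorusSite 3 L) 2) *ᵥ ψ₀) ⬝ᵥ
          ((totalSpin 1 0 + I • totalSpin 1 1 : Op (TorusSite 3 L) 2) *ᵥ ψ₀)).re *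
        (star ψ₁ ⬝ᵥ ψ₁).re ≤
      ‖star ψ₁ ⬝ᵥ ((totalSpin 1 0 + I • totalSpin 1 1 : Op (TorusSite 3 L) 2) *ᵥ ψ₀)‖ ^ 2 := by
  subst hM₀ hM₁ ht
  have hL3 : 8 ≤ L ^ 3 :=
    calc 8 = 2 ^ 3 := by norm_num
      _ ≤ L ^ 3 := Nat.pow_le_pow_left hL 3
  have hLr : (2 : ℝ) ≤ L := by exact_mod_cast hL
  have hL3r : (8 : ℝ) ≤ (L : ℝ) ^ 3 := by exact_mod_cast hL3
  have hcard := iil_card_real L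
  set w := (totalSpin 1 0 + I • totalSpin 1 1 : Op (TorusSite 3 L) 2) *ᵥ ψ₀ with hw
  -- the one-particle datum and its image under `Ŝ⁺` are flat
  set α : ℂ := ψ₀ (fun z => if z ∈ ({0} : Finset (TorusSite 3 L)) then 0 else 1) with hα
  have hflat : ∀ S : Finset (TorusSite 3 L), ψ₀ (fun z => if z ∈ S then 0 else 1) =
      if S.card = 1 then α else 0 := iil_one_flat L hL ψ₀ h₀sec h₀ne h₀eig h₀nn
  have hwS : ∀ S : Finset (TorusSite 3 L), w (fun z => if z ∈ S then 0 else 1) =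
      if S.card = 2 then 2 * α else 0 := fun S => by
    rw [hw, iil_raise_flat ψ₀ 1 α hflat S]
    norm_num
  have hwre : ∀ S : Finset (TorusSite 3 L), (w (fun z => if z ∈ S then 0 else 1)).re =
      if S.card = 2 then 2 * α.re else 0 := fun S => by
    rw [hwS S]
    split_ifs <;> simp
  have hwim : ∀ σ, (w σ).im = 0 := iil_raise_im ψ₀ (fun σ => (h₀nn σ).2)
  have h1im : ∀ σ, (ψ₁ σ).im = 0 := fun σ => (h₁nn σ).2
  have hp0 : ∀ S : Finset (TorusSite 3 L), S.card ≠ 2 → ψ₁ (fun z => if z ∈ S then 0 else 1) = 0 :=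
    iil_apply_ind_eq_zero ψ₁ 2 _ (by rw [hcard]) h₁sec
  -- the pair profile of the two-particle datum (as in `cb1tb_main`)
  set E := lowestEnergyInSector 1 (xyTorus 3 L 1) (((2 : ℕ) : ℝ) - (L : ℝ) ^ 3 / 2) with hEdef
  have hti : ∀ (a : TorusSite 3 L) (σ : TensorIndex (TorusSite 3 L) 2),
      ψ₁ (fun x => σ (x + a)) = ψ₁ σ :=
    stub_translationInvariance L hL 2 le_rfl (by omega) ψ₁ h₁sec h₁ne h₁eig h₁nn
  set g : TorusSite 3 L → ℝ := fun v => if v ∉ ({0} : Finset (TorusSite 3 L)) then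
      (ψ₁ (fun z => if z ∈ insert v ({0} : Finset (TorusSite 3 L)) then 0 else 1)).re else 0 with hg
  have hgv : ∀ v, g v = if v ∉ ({0} : Finset (TorusSite 3 L)) then
      (ψ₁ (fun z => if z ∈ insert v ({0} : Finset (TorusSite 3 L)) then 0 else 1)).re else 0 :=
    fun v => rfl
  have hg0 : g 0 = 0 := by rw [hgv]; simp
  have hgnn : ∀ v, 0 ≤ g v := fun v => by
    rw [hgv]
    split_ifs
    exacts [le_rfl, (h₁nn _).1]
  have hT1 : ∀ t x : TorusSite 3 L, (if x ∉ ({t} : Finset (TorusSite 3 L)) then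
      (ψ₁ (fun z => if z ∈ insert x ({t} : Finset (TorusSite 3 L)) then 0 else 1)).re else 0) =
        g (x - t) := by
    intro t x
    rw [hgv]
    by_cases hx : x = t
    · subst hx
      simp
    · have hx' : x ∉ ({t} : Finset (TorusSite 3 L)) := by simpa using hx
      have hx'' : x - t ∉ ({0} : Finset (TorusSite 3 L)) := by simpa [sub_eq_zero] using hx
      rw [if_pos hx', if_pos hx'', cb1tb_pair_translate L ψ₁ hti x t]
  -- the punctured resolvent equation `Σ_{y ∼ v} g y + E g v = s [v = 0]`
  have hA : ∀ v, (∑ y, if (torusGraph 3 L).Adj v y then g y else 0) + E * g v =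
      if v = 0 then (∑ y, if (torusGraph 3 L).Adj 0 y then g y else 0) else 0 := by
    intro v
    have h := stub_embedding L E ψ₁ h₁eig ({0} : Finset (TorusSite 3 L)) v
    rw [Finset.sum_singleton, Finset.erase_singleton] at h
    have hfirst : (∑ b, if b ∉ ({0} : Finset (TorusSite 3 L)) ∧ (torusGraph 3 L).Adj 0 b then
        (if v ∉ insert b (∅ : Finset (TorusSite 3 L)) then
          (ψ₁ (fun z => if z ∈ insert v (insert b (∅ : Finset (TorusSite 3 L))) then 0 else 1)).re
        else 0) else 0) = ∑ y, if (torusGraph 3 L).Adj v y then g y else 0 := by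
      calc (∑ b, if b ∉ ({0} : Finset (TorusSite 3 L)) ∧ (torusGraph 3 L).Adj 0 b then
            (if v ∉ insert b (∅ : Finset (TorusSite 3 L)) then
              (ψ₁ (fun z => if z ∈ insert v (insert b (∅ : Finset (TorusSite 3 L))) then 0 else 1)).re
            else 0) else 0)
          = ∑ b, if (torusGraph 3 L).Adj 0 b then g (v - b) else 0 := by
            refine Finset.sum_congr rfl fun b _ => ?_
            by_cases hb : (torusGraph 3 L).Adj 0 b
            · rw [if_pos ⟨by simpa using hb.ne.symm, hb⟩, if_pos hb]
              exact hT1 b v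
            · rw [if_neg (fun h' => hb h'.2), if_neg hb]
        _ = ∑ y, if (torusGraph 3 L).Adj v y then g y else 0 := by
            refine Fintype.sum_equiv (Equiv.subLeft v) _ _ fun b => ?_
            rw [Equiv.subLeft_apply]
            have hiff : (torusGraph 3 L).Adj 0 b ↔ (torusGraph 3 L).Adj v (v - b) := by
              rw [cb1tb_adj_iff_sub v (v - b), sub_sub_cancel_left, (torusGraph 3 L).adj_comm 0 b,
                cb1tb_adj_iff_sub b 0, zero_sub]
            by_cases hb : (torusGraph 3 L).Adj 0 b
            · rw [if_pos hb, if_pos (hiff.1 hb)]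
            · rw [if_neg hb, if_neg (fun h' => hb (hiff.2 h'))]
    have hsecond : ∀ y, (if y ∉ ({0} : Finset (TorusSite 3 L)) then
        (ψ₁ (fun z => if z ∈ insert y ({0} : Finset (TorusSite 3 L)) then 0 else 1)).re else 0) =
          g y := fun y => rfl
    rw [hfirst] at h
    simp only [hsecond] at h
    by_cases hv : v = 0
    · subst hv
      simp only [Finset.mem_singleton, if_true] at h ⊢
      linarith
    · rw [if_neg hv]
      rw [if_neg (by simpa using hv)] at h
      linarith
  -- two-body `ℓ²`-flatness of the pair profile
  have hFg := hF g E _ hgnn hg0 (cb1tb_energy_bound L hL) hA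
  -- pair amplitudes through the profile, and the two pair sums
  have hpair : ∀ x y : TorusSite 3 L, (if x = y then (0 : ℝ) else
      (ψ₁ (fun z => if z ∈ ({x, y} : Finset (TorusSite 3 L)) then 0 else 1)).re) = g (x - y) := by
    intro x y
    by_cases hxy : x = y
    · subst hxy
      rw [if_pos rfl, sub_self, hg0]
    · rw [if_neg hxy, ← hT1 y x, if_pos (by simpa using hxy)]
  have hshift : ∀ h : TorusSite 3 L → ℝ,
      ∑ x : TorusSite 3 L, ∑ y, h (x - y) = (L : ℝ) ^ 3 * ∑ v, h v := by
    intro h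
    have h1 : ∀ x : TorusSite 3 L, ∑ y, h (x - y) = ∑ v, h v := fun x =>
      Equiv.sum_comp (Equiv.subLeft x) h
    simp only [h1]
    rw [Finset.sum_const, Finset.card_univ, nsmul_eq_mul, hcard]
  have hsum1 : ∑ S ∈ (univ : Finset (TorusSite 3 L)).powersetCard 2,
      (ψ₁ (fun z => if z ∈ S then 0 else 1)).re = (L : ℝ) ^ 3 / 2 * ∑ v, g v := by
    have h := iil_sum_pairs (fun S : Finset (TorusSite 3 L) => (ψ₁ (fun z => if z ∈ S then 0 else 1)).re)
    have h2 : ∑ x : TorusSite 3 L, ∑ y, g (x - y) =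
        2 * ∑ S ∈ (univ : Finset (TorusSite 3 L)).powersetCard 2,
          (ψ₁ (fun z => if z ∈ S then 0 else 1)).re := by
      rw [← h]
      exact Finset.sum_congr rfl fun x _ => Finset.sum_congr rfl fun y _ => (hpair x y).symm
    rw [hshift] at h2
    linarith
  have hsum2 : ∑ S ∈ (univ : Finset (TorusSite 3 L)).powersetCard 2,
      (ψ₁ (fun z => if z ∈ S then 0 else 1)).re ^ 2 = (L : ℝ) ^ 3 / 2 * ∑ v, g v ^ 2 := by
    have h := iil_sum_pairs
      (fun S : Finset (TorusSite 3 L) => (ψ₁ (fun z => if z ∈ S then 0 else 1)).re ^ 2)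
    have hpair2 : ∀ x y : TorusSite 3 L, (if x = y then (0 : ℝ) else
        (ψ₁ (fun z => if z ∈ ({x, y} : Finset (TorusSite 3 L)) then 0 else 1)).re ^ 2) =
          g (x - y) ^ 2 := by
      intro x y
      rw [← hpair x y]
      split_ifs <;> ring
    have h2 : ∑ x : TorusSite 3 L, ∑ y, g (x - y) ^ 2 =
        2 * ∑ S ∈ (univ : Finset (TorusSite 3 L)).powersetCard 2,
          (ψ₁ (fun z => if z ∈ S then 0 else 1)).re ^ 2 := by
      rw [← h]
      exact Finset.sum_congr rfl fun x _ => Finset.sum_congr rfl fun y _ => (hpair2 x y).symm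
    rw [hshift (fun v => g v ^ 2)] at h2
    linarith
  -- the three quantities
  have hX : star ψ₁ ⬝ᵥ w = (((L : ℝ) ^ 3 * α.re * ∑ v, g v : ℝ) : ℂ) := by
    rw [iil_star_dotProduct_real ψ₁ w h1im hwim, iil_sum_config (fun σ => (ψ₁ σ).re * (w σ).re)]
    congr 1
    calc ∑ S : Finset (TorusSite 3 L), (ψ₁ (fun z => if z ∈ S then 0 else 1)).re *
          (w (fun z => if z ∈ S then 0 else 1)).re
        = ∑ S : Finset (TorusSite 3 L), 2 * α.re * (ψ₁ (fun z => if z ∈ S then 0 else 1)).re := by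
          refine Finset.sum_congr rfl fun S _ => ?_
          rw [hwre S]
          by_cases hS : S.card = 2
          · rw [if_pos hS]
            ring
          · rw [if_neg hS, hp0 S hS, Complex.zero_re]
            ring
      _ = 2 * α.re * ∑ S ∈ (univ : Finset (TorusSite 3 L)).powersetCard 2,
            (ψ₁ (fun z => if z ∈ S then 0 else 1)).re := by
          rw [← Finset.mul_sum, iil_sum_eq_sum_powersetCard
            (fun S : Finset (TorusSite 3 L) => (ψ₁ (fun z => if z ∈ S then 0 else 1)).re) 2
            fun S hS => by rw [hp0 S hS, Complex.zero_re]]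
      _ = (L : ℝ) ^ 3 * α.re * ∑ v, g v := by
          rw [hsum1]
          ring
  have hY : (star w ⬝ᵥ w).re = 2 * α.re ^ 2 * (L : ℝ) ^ 3 * ((L : ℝ) ^ 3 - 1) := by
    rw [iil_star_dotProduct_real w w hwim hwim, Complex.ofReal_re,
      iil_sum_config (fun σ => (w σ).re * (w σ).re)]
    calc ∑ S : Finset (TorusSite 3 L), (w (fun z => if z ∈ S then 0 else 1)).re *
          (w (fun z => if z ∈ S then 0 else 1)).re
        = ∑ S : Finset (TorusSite 3 L), (if S.card = 2 then 4 * α.re ^ 2 else 0) := by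
          refine Finset.sum_congr rfl fun S _ => ?_
          rw [hwre S]
          split_ifs <;> ring
      _ = ((Fintype.card (TorusSite 3 L)).choose 2 : ℝ) * (4 * α.re ^ 2) := iil_sum_card_ite 2 _
      _ = 2 * α.re ^ 2 * (L : ℝ) ^ 3 * ((L : ℝ) ^ 3 - 1) := by
          rw [Nat.cast_choose_two, hcard]
          ring
  have hZ : (star ψ₁ ⬝ᵥ ψ₁).re = (L : ℝ) ^ 3 / 2 * ∑ v, g v ^ 2 := by
    rw [iil_star_dotProduct_real ψ₁ ψ₁ h1im h1im, Complex.ofReal_re,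
      iil_sum_config (fun σ => (ψ₁ σ).re * (ψ₁ σ).re), ← hsum2,
      iil_sum_eq_sum_powersetCard
        (fun S : Finset (TorusSite 3 L) => (ψ₁ (fun z => if z ∈ S then 0 else 1)).re *
          (ψ₁ (fun z => if z ∈ S then 0 else 1)).re) 2
        fun S hS => by rw [hp0 S hS, Complex.zero_re, mul_zero]]
    exact Finset.sum_congr rfl fun S _ => by ring
  rw [hX, hY, hZ, Complex.norm_real, Real.norm_eq_abs, sq_abs]
  -- the final arithmetic
  have hQ : 0 ≤ ∑ v, g v ^ 2 := Finset.sum_nonneg fun v _ => sq_nonneg (g v)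
  have hV0 : (0 : ℝ) < (L : ℝ) ^ 3 := by positivity
  have hV1 : (0 : ℝ) ≤ (L : ℝ) ^ 3 - 1 := by linarith
  have hs0 : 0 < Real.sqrt ((L : ℝ) ^ 3 * 2) := Real.sqrt_pos.2 (by positivity)
  have hsle : Real.sqrt ((L : ℝ) ^ 3 * 2) ≤ 3 / 2 * (L : ℝ) ^ 2 := by
    rw [Real.sqrt_le_left]
    · nlinarith [mul_le_mul_of_nonneg_right hLr (sq_nonneg (L : ℝ))]
    · positivity
  have hκε : 400 / (L : ℝ) ^ 2 ≤ 600 / Real.sqrt ((L : ℝ) ^ 3 * 2) := by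
    rw [div_le_div_iff₀ (by positivity) hs0]
    nlinarith [hsle]
  have hε0 : (0 : ℝ) ≤ 400 / (L : ℝ) ^ 2 := by positivity
  have hκ0 : (0 : ℝ) ≤ 600 / Real.sqrt ((L : ℝ) ^ 3 * 2) := by positivity
  set κ := 600 / Real.sqrt ((L : ℝ) ^ 3 * 2) with hκ
  by_cases hk : 1 - κ ≤ 0
  · have h1 : (1 - κ) * (2 * α.re ^ 2 * (L : ℝ) ^ 3 * ((L : ℝ) ^ 3 - 1)) *
        ((L : ℝ) ^ 3 / 2 * ∑ v, g v ^ 2) ≤ 0 :=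
      mul_nonpos_of_nonpos_of_nonneg
        (mul_nonpos_of_nonpos_of_nonneg hk (mul_nonneg (by positivity) hV1)) (by positivity)
    exact h1.trans (sq_nonneg _)
  · push Not at hk
    have hcoef : 0 ≤ (1 - κ) * α.re ^ 2 * (L : ℝ) ^ 3 * ((L : ℝ) ^ 3 - 1) :=
      mul_nonneg (mul_nonneg (mul_nonneg hk.le (sq_nonneg _)) hV0.le) hV1
    have hone : (1 - κ) * (1 + 400 / (L : ℝ) ^ 2) ≤ 1 := by
      nlinarith [mul_nonneg hκ0 hε0]
    calc (1 - κ) * (2 * α.re ^ 2 * (L : ℝ) ^ 3 * ((L : ℝ) ^ 3 - 1)) *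
          ((L : ℝ) ^ 3 / 2 * ∑ v, g v ^ 2)
        = ((1 - κ) * α.re ^ 2 * (L : ℝ) ^ 3 * ((L : ℝ) ^ 3 - 1)) *
            ((L : ℝ) ^ 3 * ∑ v, g v ^ 2) := by ring
      _ ≤ ((1 - κ) * α.re ^ 2 * (L : ℝ) ^ 3 * ((L : ℝ) ^ 3 - 1)) *
            ((1 + 400 / (L : ℝ) ^ 2) * (∑ v, g v) ^ 2) :=
          mul_le_mul_of_nonneg_left hFg hcoef
      _ = ((1 - κ) * (1 + 400 / (L : ℝ) ^ 2)) * ((L : ℝ) ^ 3 - 1) *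
            (α.re ^ 2 * (L : ℝ) ^ 3 * (∑ v, g v) ^ 2) := by ring
      _ ≤ 1 * (L : ℝ) ^ 3 * (α.re ^ 2 * (L : ℝ) ^ 3 * (∑ v, g v) ^ 2) := by
          apply mul_le_mul_of_nonneg_right _ (by positivity)
          exact mul_le_mul hone (by linarith) hV1 zero_le_one
      _ = ((L : ℝ) ^ 3 * α.re * ∑ v, g v) ^ 2 := by ring

/-- **Stub A-low — `InsertionInfidelityBound`, rungs `N ≤ 1`, from two-body `ℓ²`-flatness.** Given
Stub F, there is `K` such that the insertion-fidelity inequality of Stub A holds on the rungs `N = 0`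
(vacuum → one particle: `Ŝ⁺|⇓⟩` IS the one-particle ground vector, fidelity `1`) and `N = 1` (one → two
particles: `ψ₀` is constant on singletons, `Ŝ⁺ψ₀ = 2a·1_{pairs}`, `ψ₁(1_{x,y}) = g(y − x)` for the pair
profile `g` of the landed two-body embedding, and the inequality is `(1 − K/√(2L³))(L³ − 1)Σg² ≤ (Σg)²`,
which Stub F gives with `K = 600`). [folklore] -/
theorem stub_insertionInfidelityLow :
    (∀ (L : ℕ) [NeZero L], 2 ≤ L → ∀ (g : TorusSite 3 L → ℝ) (E s : ℝ),
      (∀ v, 0 ≤ g v) → g 0 = 0 →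
      ((∑ b : TorusSite 3 L, (if (torusGraph 3 L).Adj 0 b then (1 : ℝ) else 0)) + E) *
          ((L : ℝ) ^ 3 - 1) ≤ 6 →
      (∀ v, (∑ y, if (torusGraph 3 L).Adj v y then g y else 0) + E * g v =
        if v = 0 then s else 0) →
      (L : ℝ) ^ 3 * ∑ v, g v ^ 2 ≤ (1 + 400 / (L : ℝ) ^ 2) * (∑ v, g v) ^ 2) →
    ∃ K : ℝ, ∀ (L : ℕ) [NeZero L], 2 ≤ L → ∀ N : ℕ, N ≤ 1 → 2 * (N + 1) ≤ L ^ 3 →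
      ∀ ψ₀ ψ₁ : TensorIndex (TorusSite 3 L) 2 → ℂ,
        ψ₀ ≠ 0 → (∀ σ, 0 ≤ (ψ₀ σ).re ∧ (ψ₀ σ).im = 0) →
        ψ₀ ∈ spinZSector 1 ((N : ℝ) - (L : ℝ) ^ 3 / 2) →
        (xyTorus 3 L 1) *ᵥ ψ₀ =
          ((lowestEnergyInSector 1 (xyTorus 3 L 1) ((N : ℝ) - (L : ℝ) ^ 3 / 2) : ℝ) : ℂ) • ψ₀ →
        ψ₁ ≠ 0 → (∀ σ, 0 ≤ (ψ₁ σ).re ∧ (ψ₁ σ).im = 0) →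
        ψ₁ ∈ spinZSector 1 (((N + 1 : ℕ) : ℝ) - (L : ℝ) ^ 3 / 2) →
        (xyTorus 3 L 1) *ᵥ ψ₁ =
          ((lowestEnergyInSector 1 (xyTorus 3 L 1) (((N + 1 : ℕ) : ℝ) - (L : ℝ) ^ 3 / 2) : ℝ) : ℂ) •
            ψ₁ →
        (1 - K / Real.sqrt ((L : ℝ) ^ 3 * ((N : ℝ) + 1))) *
            (star ((totalSpin 1 0 + I • totalSpin 1 1 : Op (TorusSite 3 L) 2) *ᵥ ψ₀) ⬝ᵥ
              ((totalSpin 1 0 + I • totalSpin 1 1 : Op (TorusSite 3 L) 2) *ᵥ ψ₀)).re *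
            (star ψ₁ ⬝ᵥ ψ₁).re ≤
          ‖star ψ₁ ⬝ᵥ ((totalSpin 1 0 + I • totalSpin 1 1 : Op (TorusSite 3 L) 2) *ᵥ ψ₀)‖ ^ 2 := by
  intro hF
  refine ⟨600, ?_⟩
  intro L _ hL N hN1 _ ψ₀ ψ₁ h₀ne h₀nn h₀sec h₀eig h₁ne h₁nn h₁sec h₁eig
  obtain rfl | rfl : N = 0 ∨ N = 1 := by omega
  · exact iil_rung_zero L hL _ _ _ rfl (by norm_num) ψ₀ ψ₁ h₀nn h₀sec h₁ne h₁nn h₁sec h₁eig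
  · exact iil_rung_one L hL (hF L hL) _ _ _ (by norm_num) rfl (by norm_num) ψ₀ ψ₁ h₀ne h₀nn h₀sec
      h₀eig h₁ne h₁nn h₁sec h₁eig

end Summit.AtomisticToContinuum.BoseEinsteinCondensation.Cruxes.KineticLatticeBEC.SectorLadder

end
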